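import Mathlib
import HarnessLib
import Summits.Ventures.LatticeQCDFlow.Exactness.NCMCGeneralSpaceRestartChainGammaCoverage
import Summits.Ventures.LatticeQCDFlow.Exactness.NCMCGeneralSpaceRestartChainVarianceFloor
import Summits.Ventures.LatticeQCDFlow.Exactness.NCMCGeneralSpaceWilsonHeatBathBar
import Summits.Ventures.LatticeQCDFlow.Exactness.NCMCGeneralSpaceOccupancyChainSweeps

/-!
# The engine's Jarzynski lane on the torus, heat-bath / Cabibbo–Marinari / composite sweeps between launches: the printed Γ-method error bar of `ΔF̂_n` is asymptotically exact from EVERY initial gauge field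

HONEST FRAMING: exact (Metropolis-corrected) sampling algorithms for lattice gauge theory;
figures of merit are autocorrelation/cost numbers at stated couplings and volumes; no
continuum-physics claim.

Venture `LatticeQCDFlow` (cell pub-lqcd), topic `Exactness`; FANOUT row 13 (`eng-snf`, GEN-22).
NEW WORK of the cell, not a published result; no definition is introduced; nothing is cited as a
fact.  END-TO-END instance of GEN-22's abstract files `NCMCGeneralSpaceRestartChainGammaCoverage`
(the printed interval
`dF ± z √(Γ̂(0) · 2 τ̂_W / n) / Ȳ_n` is asymptotically exact when `σ²_w > 0`) and
`NCMCGeneralSpaceRestartChainVarianceFloor` (`σ²_w > 0` as soon as the work has positive mean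
conditional variance given the launch configuration) — with row 9's torus Wilson single-link
heat-bath scan as the level sampler between launches (`wilson_heatBathSweep_package`, GEN-16
`NCMCGeneralSpaceWilsonHeatBathBar`: Markov, `wilsonWeight`-invariant, minorised by a non-zero finite
measure from every configuration).  This is `latflow-snf`'s default lane `updates.sweep(…, 'hb')`
between `protocol` launches on `SU(2)` / `U(1)` (and any compact second-countable `G`).

## Content (torus Wilson theory: `G` compact second countable, `ρ` continuous, `L ≠ 0`, any `β`, `d`;
## ANY Crooks pair out of `wilsonWeight ρ β` with `e^{−ΔF} = Z₁/Z_β` and bounded-below work `−B ≤ W`;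
## the heat-bath scan over an edge list visiting every edge between launches; `U₀` ANY initial field)

* **`CrooksPair.tendsto_measure_jarzynskiEstimate_mem_gammaInterval_wilsonHeatBathRestart_everyStart`**
  — `σ²_w > 0`, windows `W_n → ∞`, `W_n³/n → 0`, `z > 0`:
  `P{ |ΔF̂_n − ΔF| ≤ z √(Γ̂_n(0) · 2 τ̂_{n,W_n} / n) / Ȳ_n } → gaussianReal 0 1 (Icc (−z) z)`.
* **`CrooksPair.tendsto_measure_jarzynskiEstimate_mem_gammaInterval_wilsonHeatBathRestart_of_condVar`**
  — the same with `σ²_w > 0` REPLACED by the checkable `∫ Var_{κF(U,·)}(e^{−W}) d(Z_β⁻¹ wilsonWeight) > 0`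
  (a stochastic protocol whose work is not a function of the launch field).
* §2, gauge group `SU(N)` with row 9's Cabibbo–Marinari sweep `latSweep` (the SU(3) engine's
  `lc_sweep`) between launches (`wilson_cmSweep_package`, GEN-17):
  **`CrooksPair.tendsto_measure_jarzynskiEstimate_mem_gammaInterval_wilsonCMSweepRestart_of_condVar`**.

* §3, `composite_sweep` (`1HB + n_or OR`): the heat-bath scan followed by ANY `wilsonWeight`-invariant
  Markov kernel `η` between launches (GEN-16 `measure_le_comp`):
  **`CrooksPair.tendsto_measure_jarzynskiEstimate_mem_gammaInterval_wilsonHeatBathCompRestart_of_condVar`**.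

NOT CLAIMED: the CLT of `√n (ΔF̂_n − ΔF)` itself in this setting (a one-line instance of
`NCMCGeneralSpaceRestartChainCLT`, kept for the sibling file `NCMCGeneralSpaceWilsonHeatBathRestartCLT`);
unbounded work; any value of `σ²_w`, `τ_int` or a number of ours; anything numerical.
-/

namespace Summit.Ventures.LatticeQCDFlow.Exactness.GeneralNCMC

open MeasureTheory ProbabilityTheory Set Filter Finset
open scoped ENNReal Topology

section Wilson

open Literature.MathematicalPhysics.QuantumFieldTheory

variable {d L N : ℕ} {G : Type*} [Group G] [TopologicalSpace G] [IsTopologicalGroup G]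
  (ρ : G →* Matrix (Fin N) (Fin N) ℂ) [CompactSpace G] [MeasurableSpace G] [BorelSpace G]
  [SecondCountableTopology G]

/-- **THE PRINTED Γ-METHOD ERROR BAR OF THE ENGINE'S JARZYNSKI LANE IS ASYMPTOTICALLY EXACT FROM
EVERY INITIAL GAUGE FIELD.**  Torus Wilson theory, compact second-countable `G`, continuous `ρ`,
`L ≠ 0`; ANY Crooks pair out of `wilsonWeight ρ β` with `e^{−ΔF} = Z₁/Z_β` and bounded-below work
`−B ≤ W`; the single-link heat-bath scan over an edge list visiting every edge between launches;
`σ²_w > 0` (the Green–Kubo variance of the weights along the record chain); windows `W_n → ∞` with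
`W_n³/n → 0`; `z > 0`.  For EVERY initial gauge field `U₀`:
`P{ |ΔF̂_n − ΔF| ≤ z √(Γ̂_n(0) · 2 τ̂_{n,W_n} / n) / Ȳ_n } → gaussianReal 0 1 (Icc (−z) z)`. -/
theorem CrooksPair.tendsto_measure_jarzynskiEstimate_mem_gammaInterval_wilsonHeatBathRestart_everyStart
    [NeZero L] (hρ : Continuous ρ) (β : ℝ) {l : List (Edge d L)} (hl : ∀ ed, ed ∈ l) {E : Type*}
    [MeasurableSpace E] {ν₁ : Measure (GaugeConfig d L G)} [IsFiniteMeasure ν₁]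
    {κF κR : Kernel (GaugeConfig d L G) E} [IsMarkovKernel κF] [IsMarkovKernel κR]
    {s e : E → GaugeConfig d L G} {W : E → ℝ}
    (h : CrooksPair (wilsonWeight (d := d) (L := L) ρ β) ν₁ κF κR s e W) {ΔF : ℝ}
    (hΔF : Real.exp (-ΔF) = (((wilsonWeight (d := d) (L := L) ρ β) univ)⁻¹ * ν₁ univ).toReal)
    {B : ℝ} (hB : ∀ ω, -B ≤ W ω)
    (hσ : 0 < Scoring.autocov ((κF ∘ₖ cycle (l.map (siteHeatBath (fun _ : Edge d L => haarProbability G)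
            (gibbsDensity fun U : GaugeConfig d L G => β * wilsonAction ρ U)))).comap s h.measurable_s)
          (fwdPathLaw (wilsonWeight (d := d) (L := L) ρ β) κF)
          (fun ω => Real.exp (-W ω) - (((wilsonWeight (d := d) (L := L) ρ β) univ)⁻¹ * ν₁ univ).toReal) 0
        + 2 * ∑' t, Scoring.autocov ((κF ∘ₖ cycle (l.map (siteHeatBath
            (fun _ : Edge d L => haarProbability G)
            (gibbsDensity fun U : GaugeConfig d L G => β * wilsonAction ρ U)))).comap s h.measurable_s)
          (fwdPathLaw (wilsonWeight (d := d) (L := L) ρ β) κF)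
          (fun ω => Real.exp (-W ω) - (((wilsonWeight (d := d) (L := L) ρ β) univ)⁻¹ * ν₁ univ).toReal)
          (t + 1))
    {Wn : ℕ → ℕ} (hW : Tendsto Wn atTop atTop)
    (hW3 : Tendsto (fun n => (Wn n : ℝ) ^ 3 / n) atTop (𝓝 0)) {z : ℝ} (hz : 0 < z) :
    ∃ (_ : IsMarkovKernel (cycle (l.map (siteHeatBath (fun _ : Edge d L => haarProbability G)
        (gibbsDensity fun U : GaugeConfig d L G => β * wilsonAction ρ U))))),
      ∀ U₀ : GaugeConfig d L G,
        Tendsto (fun n : ℕ => (Kernel.trajMeasure (X := fun _ : ℕ => E) (κF U₀)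
            (fun n : ℕ => ((κF ∘ₖ cycle (l.map (siteHeatBath (fun _ : Edge d L => haarProbability G)
              (gibbsDensity fun U : GaugeConfig d L G => β * wilsonAction ρ U)))).comap s
                h.measurable_s).comap
              (fun hh : (j : ↥(Finset.Iic n)) → E => hh ⟨n, Finset.mem_Iic.2 le_rfl⟩)
              (measurable_pi_apply _)))
            {ω : ℕ → E | |jarzynskiEstimate (fun ε => Real.exp (-W ε)) (fun i : Fin n => ω i) - ΔF|
              ≤ z * Real.sqrt (Scoring.gammaHat (fun i => Real.exp (-W (ω i))) n 0
                  * (2 * Scoring.tauIntWindow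
                    (Scoring.rhoHat (fun i => Real.exp (-W (ω i))) n) (Wn n)) / n)
                / sampleMean (fun ε => Real.exp (-W ε)) (fun i : Fin n => ω i)})
          atTop (𝓝 (gaussianReal 0 1 (Icc (-z) z))) := by
  obtain ⟨hMk, hfin, m, hmfin, h0, hm0, hK, hmin⟩ := wilson_heatBathSweep_package ρ hρ β hl
  haveI := hMk
  haveI := hfin
  haveI := hmfin
  exact ⟨hMk, fun U₀ =>
    h.tendsto_measure_jarzynskiEstimate_mem_gammaInterval_restartChain_everyStart _ h0 hK hΔF hm0 hmin
      hB hσ hW hW3 hz U₀⟩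

/-- **… WITH THE CHECKABLE HYPOTHESIS**: the same exact asymptotic coverage from every initial gauge
field when, instead of `σ²_w > 0`, the work has positive mean conditional variance given the launch
field, `0 < ∫ (∫ (e^{−W} − ∫ e^{−W} dκF(U,·))² dκF(U,·)) d(Z_β⁻¹ wilsonWeight ρ β)(U)`. -/
theorem CrooksPair.tendsto_measure_jarzynskiEstimate_mem_gammaInterval_wilsonHeatBathRestart_of_condVar
    [NeZero L] (hρ : Continuous ρ) (β : ℝ) {l : List (Edge d L)} (hl : ∀ ed, ed ∈ l) {E : Type*}
    [MeasurableSpace E] {ν₁ : Measure (GaugeConfig d L G)} [IsFiniteMeasure ν₁]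
    {κF κR : Kernel (GaugeConfig d L G) E} [IsMarkovKernel κF] [IsMarkovKernel κR]
    {s e : E → GaugeConfig d L G} {W : E → ℝ}
    (h : CrooksPair (wilsonWeight (d := d) (L := L) ρ β) ν₁ κF κR s e W) {ΔF : ℝ}
    (hΔF : Real.exp (-ΔF) = (((wilsonWeight (d := d) (L := L) ρ β) univ)⁻¹ * ν₁ univ).toReal)
    {B : ℝ} (hB : ∀ ω, -B ≤ W ω)
    (hV : 0 < ∫ U, ∫ ω, (Real.exp (-W ω) - ∫ ω', Real.exp (-W ω') ∂(κF U)) ^ 2 ∂(κF U)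
      ∂(((wilsonWeight (d := d) (L := L) ρ β) univ)⁻¹ • wilsonWeight (d := d) (L := L) ρ β))
    {Wn : ℕ → ℕ} (hW : Tendsto Wn atTop atTop)
    (hW3 : Tendsto (fun n => (Wn n : ℝ) ^ 3 / n) atTop (𝓝 0)) {z : ℝ} (hz : 0 < z) :
    ∃ (_ : IsMarkovKernel (cycle (l.map (siteHeatBath (fun _ : Edge d L => haarProbability G)
        (gibbsDensity fun U : GaugeConfig d L G => β * wilsonAction ρ U))))),
      ∀ U₀ : GaugeConfig d L G,
        Tendsto (fun n : ℕ => (Kernel.trajMeasure (X := fun _ : ℕ => E) (κF U₀)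
            (fun n : ℕ => ((κF ∘ₖ cycle (l.map (siteHeatBath (fun _ : Edge d L => haarProbability G)
              (gibbsDensity fun U : GaugeConfig d L G => β * wilsonAction ρ U)))).comap s
                h.measurable_s).comap
              (fun hh : (j : ↥(Finset.Iic n)) → E => hh ⟨n, Finset.mem_Iic.2 le_rfl⟩)
              (measurable_pi_apply _)))
            {ω : ℕ → E | |jarzynskiEstimate (fun ε => Real.exp (-W ε)) (fun i : Fin n => ω i) - ΔF|
              ≤ z * Real.sqrt (Scoring.gammaHat (fun i => Real.exp (-W (ω i))) n 0
                  * (2 * Scoring.tauIntWindow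
                    (Scoring.rhoHat (fun i => Real.exp (-W (ω i))) n) (Wn n)) / n)
                / sampleMean (fun ε => Real.exp (-W ε)) (fun i : Fin n => ω i)})
          atTop (𝓝 (gaussianReal 0 1 (Icc (-z) z))) := by
  obtain ⟨hMk, hfin, m, hmfin, h0, hm0, hK, hmin⟩ := wilson_heatBathSweep_package ρ hρ β hl
  haveI := hMk
  haveI := hfin
  haveI := hmfin
  have hσ := h.greenKubo_variance_exp_neg_work_restartChain_pos_of_condVar _ h0 hK hm0 hmin hB hV
  exact ⟨hMk, fun U₀ =>
    h.tendsto_measure_jarzynskiEstimate_mem_gammaInterval_restartChain_everyStart _ h0 hK hΔF hm0 hmin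
      hB hσ hW hW3 hz U₀⟩

end Wilson

/-! ## §2 Gauge group `SU(N)`: Cabibbo–Marinari sweeps between launches -/

section CM

open Literature.MathematicalPhysics.QuantumFieldTheory

variable {n : Type*} [Fintype n] [DecidableEq n] [Nonempty n] [LinearOrder n]
variable {m : Type*} [Fintype m] [DecidableEq m]
variable {d L N : ℕ} (ρ : Matrix.specialUnitaryGroup n ℂ →* Matrix (Fin N) (Fin N) ℂ)

/-- **THE PRINTED Γ-METHOD ERROR BAR OF THE SU(N) ENGINE'S JARZYNSKI LANE IS ASYMPTOTICALLY EXACT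
FROM EVERY INITIAL GAUGE FIELD** (Cabibbo–Marinari sweeps between launches), under the checkable
hypothesis that the work has positive mean conditional variance given the launch field; windows
`W_k → ∞`, `W_k³/k → 0`; `z > 0`:
`P{ |ΔF̂_k − ΔF| ≤ z √(Γ̂_k(0) · 2 τ̂_{k,W_k} / k) / Ȳ_k } → gaussianReal 0 1 (Icc (−z) z)`. -/
theorem CrooksPair.tendsto_measure_jarzynskiEstimate_mem_gammaInterval_wilsonCMSweepRestart_of_condVar
    [NeZero L] (hρ : Continuous ρ) (β : ℝ) (frames : List (n ≃ Fin 2 ⊕ m))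
    (hlex : frames.map pairOf = lexPairs (Finset.univ.sort (· ≤ ·) : List n) ∨
      frames.map pairOf = (lexPairs (Finset.univ.sort (· ≤ ·) : List n)).reverse)
    {links : List (Edge d L)} (hl : ∀ ed, ed ∈ links) {E : Type*} [MeasurableSpace E]
    {ν₁ : Measure (GaugeConfig d L (Matrix.specialUnitaryGroup n ℂ))} [IsFiniteMeasure ν₁]
    {κF κR : Kernel (GaugeConfig d L (Matrix.specialUnitaryGroup n ℂ)) E} [IsMarkovKernel κF]
    [IsMarkovKernel κR] {s e : E → GaugeConfig d L (Matrix.specialUnitaryGroup n ℂ)} {W : E → ℝ}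
    (h : CrooksPair (wilsonWeight (d := d) (L := L) ρ β) ν₁ κF κR s e W) {ΔF : ℝ}
    (hΔF : Real.exp (-ΔF) = (((wilsonWeight (d := d) (L := L) ρ β) univ)⁻¹ * ν₁ univ).toReal)
    {B : ℝ} (hB : ∀ ω, -B ≤ W ω)
    (hV : 0 < ∫ U, ∫ ω, (Real.exp (-W ω) - ∫ ω', Real.exp (-W ω') ∂(κF U)) ^ 2 ∂(κF U)
      ∂(((wilsonWeight (d := d) (L := L) ρ β) univ)⁻¹ • wilsonWeight (d := d) (L := L) ρ β))
    {Wn : ℕ → ℕ} (hW : Tendsto Wn atTop atTop)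
    (hW3 : Tendsto (fun k => (Wn k : ℝ) ^ 3 / k) atTop (𝓝 0)) {z : ℝ} (hz : 0 < z) :
    ∃ (_ : IsMarkovKernel (latSweep (gibbsDensity fun U : GaugeConfig d L
        (Matrix.specialUnitaryGroup n ℂ) => β * wilsonAction ρ U) frames links)),
      ∀ U₀ : GaugeConfig d L (Matrix.specialUnitaryGroup n ℂ),
        Tendsto (fun k : ℕ => (Kernel.trajMeasure (X := fun _ : ℕ => E) (κF U₀)
            (fun k : ℕ => ((κF ∘ₖ latSweep (gibbsDensity fun U : GaugeConfig d L
              (Matrix.specialUnitaryGroup n ℂ) => β * wilsonAction ρ U) frames links).comap s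
                h.measurable_s).comap
              (fun hh : (j : ↥(Finset.Iic k)) → E => hh ⟨k, Finset.mem_Iic.2 le_rfl⟩)
              (measurable_pi_apply _)))
            {ω : ℕ → E | |jarzynskiEstimate (fun ε => Real.exp (-W ε)) (fun i : Fin k => ω i) - ΔF|
              ≤ z * Real.sqrt (Scoring.gammaHat (fun i => Real.exp (-W (ω i))) k 0
                  * (2 * Scoring.tauIntWindow
                    (Scoring.rhoHat (fun i => Real.exp (-W (ω i))) k) (Wn k)) / k)
                / sampleMean (fun ε => Real.exp (-W ε)) (fun i : Fin k => ω i)})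
          atTop (𝓝 (gaussianReal 0 1 (Icc (-z) z))) := by
  obtain ⟨hMk, hfin, mm, hmfin, h0, hm0, hK, hmin⟩ := wilson_cmSweep_package ρ hρ β frames hlex hl
  haveI := hMk
  haveI := hfin
  haveI := hmfin
  have hσ := h.greenKubo_variance_exp_neg_work_restartChain_pos_of_condVar _ h0 hK hm0 hmin hB hV
  exact ⟨hMk, fun U₀ =>
    h.tendsto_measure_jarzynskiEstimate_mem_gammaInterval_restartChain_everyStart _ h0 hK hΔF hm0 hmin
      hB hσ hW hW3 hz U₀⟩

end CM

/-! ## §3 `composite_sweep`: the heat-bath scan followed by exact updates between launches -/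

section WilsonComp

open Literature.MathematicalPhysics.QuantumFieldTheory

variable {d L N : ℕ} {G : Type*} [Group G] [TopologicalSpace G] [IsTopologicalGroup G]
  (ρ : G →* Matrix (Fin N) (Fin N) ℂ) [CompactSpace G] [MeasurableSpace G] [BorelSpace G]
  [SecondCountableTopology G]

/-- **`1HB + n_or OR` BETWEEN LAUNCHES: THE PRINTED Γ-METHOD ERROR BAR IS ASYMPTOTICALLY EXACT FROM
EVERY INITIAL GAUGE FIELD.**  Torus Wilson theory, compact second-countable `G`, continuous `ρ`,
`L ≠ 0`; the heat-bath scan over an edge list visiting every edge FOLLOWED BY ANY Markov kernel `η`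
leaving `wilsonWeight ρ β` invariant (over-relaxation sweeps); ANY Crooks pair out of
`wilsonWeight ρ β` with `e^{−ΔF} = Z₁/Z_β`, `−B ≤ W` and positive mean conditional work variance;
windows `W_n → ∞`, `W_n³/n → 0`; `z > 0`.  For EVERY initial gauge field `U₀`:
`P{ |ΔF̂_n − ΔF| ≤ z √(Γ̂_n(0) · 2 τ̂_{n,W_n} / n) / Ȳ_n } → gaussianReal 0 1 (Icc (−z) z)`. -/
theorem CrooksPair.tendsto_measure_jarzynskiEstimate_mem_gammaInterval_wilsonHeatBathCompRestart_of_condVar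
    [NeZero L] (hρ : Continuous ρ) (β : ℝ) {l : List (Edge d L)} (hl : ∀ ed, ed ∈ l)
    (η : Kernel (GaugeConfig d L G) (GaugeConfig d L G)) [IsMarkovKernel η]
    (hη : Kernel.Invariant η (wilsonWeight (d := d) (L := L) ρ β)) {E : Type*}
    [MeasurableSpace E] {ν₁ : Measure (GaugeConfig d L G)} [IsFiniteMeasure ν₁]
    {κF κR : Kernel (GaugeConfig d L G) E} [IsMarkovKernel κF] [IsMarkovKernel κR]
    {s e : E → GaugeConfig d L G} {W : E → ℝ}
    (h : CrooksPair (wilsonWeight (d := d) (L := L) ρ β) ν₁ κF κR s e W) {ΔF : ℝ}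
    (hΔF : Real.exp (-ΔF) = (((wilsonWeight (d := d) (L := L) ρ β) univ)⁻¹ * ν₁ univ).toReal)
    {B : ℝ} (hB : ∀ ω, -B ≤ W ω)
    (hV : 0 < ∫ U, ∫ ω, (Real.exp (-W ω) - ∫ ω', Real.exp (-W ω') ∂(κF U)) ^ 2 ∂(κF U)
      ∂(((wilsonWeight (d := d) (L := L) ρ β) univ)⁻¹ • wilsonWeight (d := d) (L := L) ρ β))
    {Wn : ℕ → ℕ} (hW : Tendsto Wn atTop atTop)
    (hW3 : Tendsto (fun n => (Wn n : ℝ) ^ 3 / n) atTop (𝓝 0)) {z : ℝ} (hz : 0 < z) :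
    ∃ (_ : IsMarkovKernel (cycle (l.map (siteHeatBath (fun _ : Edge d L => haarProbability G)
        (gibbsDensity fun U : GaugeConfig d L G => β * wilsonAction ρ U))))),
      ∀ U₀ : GaugeConfig d L G,
        Tendsto (fun n : ℕ => (Kernel.trajMeasure (X := fun _ : ℕ => E) (κF U₀)
            (fun n : ℕ => ((κF ∘ₖ (η ∘ₖ cycle (l.map (siteHeatBath
              (fun _ : Edge d L => haarProbability G)
              (gibbsDensity fun U : GaugeConfig d L G => β * wilsonAction ρ U))))).comap s
                h.measurable_s).comap
              (fun hh : (j : ↥(Finset.Iic n)) → E => hh ⟨n, Finset.mem_Iic.2 le_rfl⟩)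
              (measurable_pi_apply _)))
            {ω : ℕ → E | |jarzynskiEstimate (fun ε => Real.exp (-W ε)) (fun i : Fin n => ω i) - ΔF|
              ≤ z * Real.sqrt (Scoring.gammaHat (fun i => Real.exp (-W (ω i))) n 0
                  * (2 * Scoring.tauIntWindow
                    (Scoring.rhoHat (fun i => Real.exp (-W (ω i))) n) (Wn n)) / n)
                / sampleMean (fun ε => Real.exp (-W ε)) (fun i : Fin n => ω i)})
          atTop (𝓝 (gaussianReal 0 1 (Icc (-z) z))) := by
  obtain ⟨hMk, hfin, m, hmfin, h0, hm0, hK, hmin⟩ := wilson_heatBathSweep_package ρ hρ β hl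
  haveI := hMk
  haveI := hfin
  haveI := hmfin
  haveI : IsFiniteMeasure (m.bind η) := inferInstance
  have hm0' : m.bind η univ ≠ 0 := by rw [bind_apply_univ_of_markov]; exact hm0
  have hmin' := measure_le_comp _ η hmin
  have hσ := h.greenKubo_variance_exp_neg_work_restartChain_pos_of_condVar _ h0 (hη.comp hK) hm0'
    hmin' hB hV
  exact ⟨hMk, fun U₀ =>
    h.tendsto_measure_jarzynskiEstimate_mem_gammaInterval_restartChain_everyStart _ h0 (hη.comp hK)
      hΔF hm0' hmin' hB hσ hW hW3 hz U₀⟩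

end WilsonComp

end Summit.Ventures.LatticeQCDFlow.Exactness.GeneralNCMC
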